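import Literature.Barriers.ValiantsHypothesis.DepthThreeChasmTight

/-!
# Explicit `ΣΠΣ` data from a circuit of product-depth `≤ 1`
# (stub `stub_spsData` of line `Sketch`, crux `ShadowFormulaTransfer`)

A circuit `P : ArithCircuit k σ` of product-depth `≤ 1` with `E` wires over finitely many
variables computes `∑_{τ < T} c_τ · ∏_{π < D} ℓ_{τπ}` for EXPLICIT data: `T ≤ E + 1` terms, each a
scalar times a product of `D = E + 1` affine forms `ℓ_{τπ} = ∑ᵥ aᵥ Xᵥ + b` (GKKS 2016, §1 eq. (1),
the shape of a `ΣΠΣ` circuit).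

This is the data constructed inside the proof of the tree theorem
`Literature.Barriers.ValiantsHypothesis.exists_size_le_of_productDepth_le_one`
(`DepthThreeChasmTight.lean`), output instead of being fed to the circuit builder: (1) sum closure
at the output (`ArithCircuit.gateVal_mem_span_spanFamily`) writes `P.eval` as a linear
combination of `1`, the variables and the values of the product gates of product-depth `≤ 1`;
(2) every operand of such a gate has product-depth `0`, hence denotes an affine form
(`exists_affVal_opVal`); (3) the terms are indexed by the product gates with an operand (at most
`E` of them, `card_filter_fanIn_pos_le`, each of fan-in `≤ E`, `fanIn_le_edgeSize`) plus ONE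
affine term collecting the variables, the constant and the operand-free product gates (which
denote `1`); (4) lists of affine data of length `≤ D` are padded with the constant form `1`
(`prod_affVal_getD`) and the index type is enumerated by `Fin T` (`Equiv.sum_comp`).

## References

* [GuptaKamathKayalSaptharishi2016] A. Gupta, P. Kamath, N. Kayal, R. Saptharishi, *Arithmetic
  circuits: a chasm at depth three*, SIAM J. Comput. 45 (2016) 1064–1079, §1 eq. (1).
* [LimayeSrinivasanTavenas2025] N. Limaye, S. Srinivasan, S. Tavenas, *Superpolynomial lower
  bounds against low-depth algebraic circuits*, J. ACM 72 (2025), Art. 26, §7 Lemma 19 (sum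
  closure).
-/

set_option linter.dupNamespace false

noncomputable section

namespace Summit.ValiantsHypothesis.ValiantsHypothesis.Theorems.ShallowShadowsShadowFormulaTransfer

open Literature.Computability.AlgebraicComplexity Literature.Computability.Complexity
open Literature.Computability.AlgebraicComplexity.DepthThreeChasm
open MvPolynomial

section Helpers

open ArithCircuit Literature.Barriers.ValiantsHypothesis

universe u v

variable {k : Type u} {σ : Type v}

/-- Re-indexing list-fed `ΣΠΣ` data by `Fin`: `#𝒯` terms `c_τ · ∏ (A τ)` with at most `D` affine
factors each are `Fin #𝒯`-indexed terms with EXACTLY `D` affine factors (pad with the constant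
form `1`). [cite: GuptaKamathKayalSaptharishi2016, §1 eq. (1)] -/
theorem exists_fin_spsData_of_lists [CommSemiring k] [Fintype σ] {𝒯 : Type*} [Fintype 𝒯]
    (D : ℕ) (c : 𝒯 → k) (A : 𝒯 → List ((σ → k) × k)) (hA : ∀ τ, (A τ).length ≤ D) :
    ∃ (c' : Fin (Fintype.card 𝒯) → k) (ℓ : Fin (Fintype.card 𝒯) → Fin D → (σ → k) × k),
      (∑ τ, c' τ • ∏ π, affVal (ℓ τ π)) = ∑ τ, c τ • ((A τ).map affVal).prod := by
  classical
  set T := Fintype.card 𝒯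
  set e := Fintype.equivFin 𝒯
  set c' : Fin T → k := fun τ => c (e.symm τ) with hc'
  set ℓ' : Fin T → Fin D → (σ → k) × k := fun τ π => (A (e.symm τ)).getD π.val (0, 1) with hℓ'
  refine ⟨c', ℓ', ?_⟩
  rw [← e.symm.sum_comp]
  refine Fintype.sum_congr _ _ fun τ => ?_
  simp only [hc', hℓ']
  rw [prod_affVal_getD _ _ (hA _)]

/-- **Explicit `ΣΠΣ` data from a circuit of product-depth `≤ 1`** (the data behind
`exists_size_le_of_productDepth_le_one`): `P.eval = ∑_{τ<T} c_τ ∏_{π<D} affVal (ℓ τ π)` with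
`T ≤ E + 1` and `D ≤ E + 1`, `E` the wire count. [cite: GuptaKamathKayalSaptharishi2016, §1 eq. (1)] -/
theorem exists_spsData_of_productDepth_le_one [CommSemiring k] [Fintype σ] [DecidableEq σ]
    (P : ArithCircuit k σ) (hP : P.productDepth ≤ 1) :
    ∃ (T D : ℕ) (c : Fin T → k) (ℓ : Fin T → Fin D → (σ → k) × k),
      (∑ τ, c τ • ∏ π, affVal (ℓ τ π)) = P.eval ∧ T ≤ P.edgeSize + 1 ∧ D ≤ P.edgeSize + 1 := by
  classical
  -- (1) sum closure at the output
  have hmem : P.eval ∈ Submodule.span k (Set.range (P.spanFamily 1)) := by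
    rw [eval_eq_opVal_output]
    cases hout : P.output with
    | var v => exact Submodule.subset_span ⟨.inr (.inl v), rfl⟩
    | const c =>
      rw [opVal_const, MvPolynomial.C_eq_smul_one]
      exact Submodule.smul_mem _ _ (Submodule.subset_span ⟨.inr (.inr ()), rfl⟩)
    | gate j =>
      rw [opVal_gate]
      split_ifs with hj
      · have hpd : P.gatePD j ≤ 1 := by
          have h := P.productDepth_eq_opPD_output
          rw [hout, opPD_gate, if_pos hj] at h
          rw [← h]
          exact hP
        exact P.span_spanFamily_mono hpd (P.gateVal_mem_span_spanFamily j)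
      · exact Submodule.zero_mem _
  obtain ⟨c, hc⟩ := (Submodule.mem_span_range_iff_exists_fun k).1 hmem
  -- (2) affine factors of the operands of product-depth `0`
  have haff : ∀ (i : ℕ) (u : Operand k σ), ∃ φ : (σ → k) × k,
      P.opPD i u = 0 → P.opVal i u = affVal φ := by
    intro i u
    by_cases h : P.opPD i u = 0
    · obtain ⟨φ, hφ⟩ := exists_affVal_opVal P i u h
      exact ⟨φ, fun _ => hφ⟩
    · exact ⟨(0, 0), fun h' => absurd h' h⟩
  choose Φ hΦ using haff
  -- (3) the terms
  set E := P.edgeSize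
  let good : Fin P.size → Prop := fun j =>
    P.gateIsProd j = true ∧ P.gatePD j ≤ 1 ∧ 1 ≤ (P.gates[(j : ℕ)]).fanIn
  let unitGood : Fin P.size → Prop := fun j =>
    P.gateIsProd j = true ∧ P.gatePD j ≤ 1 ∧ (P.gates[(j : ℕ)]).fanIn = 0
  let b : k := c (.inr (.inr ())) + ∑ j ∈ Finset.univ.filter unitGood, c (.inl j)
  let φ₀ : (σ → k) × k := (fun v => c (.inr (.inl v)), b)
  let 𝒯 := {j : Fin P.size // good j} ⊕ Unit
  let coef : 𝒯 → k := Sum.elim (fun j => c (.inl j.1)) (fun _ => 1)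
  let A : 𝒯 → List ((σ → k) × k) :=
    Sum.elim (fun j => ((P.gates[(j.1 : ℕ)]).args).map (Φ j.1)) (fun _ => [φ₀])
  have hlen : ∀ τ, (A τ).length ≤ E + 1 := by
    rintro (j | u)
    · simp only [A, Sum.elim_inl, List.length_map]
      exact (fanIn_le_edgeSize P j.1).trans (Nat.le_succ _)
    · simp [A]
  obtain ⟨c', ℓ', hdata⟩ := exists_fin_spsData_of_lists (E + 1) coef A hlen
  -- the number of terms
  have hT : Fintype.card 𝒯 ≤ E + 1 := by
    simp only [𝒯, Fintype.card_sum, Fintype.card_unit, Fintype.card_subtype]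
    refine Nat.add_le_add_right ((Finset.card_le_card ?_).trans (card_filter_fanIn_pos_le P)) 1
    intro j hj
    simp only [Finset.mem_filter, Finset.mem_univ, true_and, good] at hj ⊢
    exact hj.2.2
  -- values of the good product gates
  have hval : ∀ j : Fin P.size, good j →
      (((P.gates[(j : ℕ)]).args.map (Φ j)).map affVal).prod = P.gateVal j := by
    rintro j ⟨hjp, hjpd, -⟩
    obtain ⟨args, hg⟩ := (P.gateIsProd_iff j).1 hjp
    have hget : P.gates[(j : ℕ)] = .prod args := by
      have := List.getElem?_eq_getElem j.2 ▸ hg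
      exact Option.some_injective _ this
    have hargs : (P.gates[(j : ℕ)]).args = args := by
      rw [hget]
      rfl
    rw [P.gateVal_of_prod hg, hargs, List.map_map]
    refine congrArg List.prod (List.map_congr_left fun u hu => ?_)
    have hop : P.opPD j u = 0 := by
      have := P.opPD_succ_le_gatePD_of_prod hg hu
      omega
    exact (hΦ j u hop).symm
  -- values of the operand-free product gates
  have hunit : ∀ j : Fin P.size, unitGood j → P.gateVal j = 1 := by
    rintro j ⟨hjp, -, hj0⟩
    obtain ⟨args, hg⟩ := (P.gateIsProd_iff j).1 hjp
    have hget : P.gates[(j : ℕ)] = .prod args := by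
      have := List.getElem?_eq_getElem j.2 ▸ hg
      exact Option.some_injective _ this
    have hnil : args = [] := by
      rw [hget] at hj0
      exact List.eq_nil_of_length_eq_zero hj0
    rw [P.gateVal_of_prod hg, hnil, List.map_nil, List.prod_nil]
  refine ⟨Fintype.card 𝒯, E + 1, c', ℓ', ?_, hT, le_rfl⟩
  -- (4) the value
  have hsplit : ∀ j : Fin P.size, c (.inl j) • P.spanFamily 1 (.inl j) =
      (if good j then c (.inl j) • P.gateVal j else 0) +
        (if unitGood j then c (.inl j) • (1 : MvPolynomial σ k) else 0) := by
    intro j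
    by_cases hp : P.gateIsProd j = true ∧ P.gatePD j ≤ 1
    · have hsf : P.spanFamily 1 (.inl j) = P.gateVal j := by
        simp [ArithCircuit.spanFamily, hp]
      rw [hsf]
      rcases Nat.eq_zero_or_pos ((P.gates[(j : ℕ)]).fanIn) with h0 | hpos
      · have hu : unitGood j := ⟨hp.1, hp.2, h0⟩
        have hng : ¬ good j := fun hg' => by
          have := hg'.2.2
          omega
        rw [if_neg hng, if_pos hu, hunit j hu, zero_add]
      · have hg' : good j := ⟨hp.1, hp.2, hpos⟩
        have hnu : ¬ unitGood j := fun hu => by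
          have := hu.2.2
          omega
        rw [if_pos hg', if_neg hnu, add_zero]
    · have hsf : P.spanFamily 1 (.inl j) = 0 := by
        simp only [ArithCircuit.spanFamily]
        rw [if_neg hp]
      have hng : ¬ good j := fun hg' => hp ⟨hg'.1, hg'.2.1⟩
      have hnu : ¬ unitGood j := fun hu => hp ⟨hu.1, hu.2.1⟩
      rw [hsf, if_neg hng, if_neg hnu, smul_zero, add_zero]
  have hsum1 : ∑ j : Fin P.size, c (.inl j) • P.spanFamily 1 (.inl j) =
      (∑ j : {j : Fin P.size // good j}, c (.inl j.1) • P.gateVal j.1) +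
        (∑ j ∈ Finset.univ.filter unitGood, c (.inl j)) • (1 : MvPolynomial σ k) := by
    rw [Finset.sum_congr rfl fun j _ => hsplit j, Finset.sum_add_distrib, ← Finset.sum_filter,
      ← Finset.sum_filter, ← Finset.sum_smul]
    congr 1
    exact (Finset.sum_subtype (Finset.univ.filter good) (by simp)
      (fun j : Fin P.size => c (.inl j) • P.gateVal j))
  have hL1 : ∑ j : {j : Fin P.size // good j}, coef (.inl j) • ((A (.inl j)).map affVal).prod =
      ∑ j : {j : Fin P.size // good j}, c (.inl j.1) • P.gateVal j.1 :=
    Fintype.sum_congr _ _ fun j => by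
      simp only [coef, A, Sum.elim_inl]
      rw [hval j.1 j.2]
  have hL2 : ∑ u : Unit, coef (.inr u) • ((A (.inr u)).map affVal).prod = affVal φ₀ := by
    simp [coef, A]
  have hR2 : ∑ v : σ, c (.inr (.inl v)) • P.spanFamily 1 (.inr (.inl v)) =
      ∑ v : σ, c (.inr (.inl v)) • (X v : MvPolynomial σ k) := rfl
  have hR3 : ∑ u : Unit, c (.inr (.inr u)) • P.spanFamily 1 (.inr (.inr u)) =
      c (.inr (.inr ())) • (1 : MvPolynomial σ k) := by
    simp [ArithCircuit.spanFamily]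
  have hφ₀ : affVal φ₀ = ∑ v : σ, c (.inr (.inl v)) • (X v : MvPolynomial σ k) +
      (c (.inr (.inr ())) • (1 : MvPolynomial σ k) +
        (∑ j ∈ Finset.univ.filter unitGood, c (.inl j)) • (1 : MvPolynomial σ k)) := by
    simp only [φ₀, b]
    rw [affVal_apply, MvPolynomial.C_eq_smul_one, add_smul]
  rw [hdata, ← hc, Fintype.sum_sum_type, hL1, hL2, Fintype.sum_sum_type, Fintype.sum_sum_type,
    hsum1, hR2, hR3, hφ₀]
  abel

end Helpers

/-- Stub SpsData (explicit `ΣΠΣ` data from a product-depth-`≤ 1` circuit): a circuit `P` over `ℂ`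
of product-depth `≤ 1` computes `∑_{τ<T} c_τ ∏_{π<D} ℓ_{τπ}` with affine `ℓ_{τπ}` and
`T, D ≤ wires + 1` (the data behind `exists_size_le_of_productDepth_le_one`).
[cite: GuptaKamathKayalSaptharishi2016, §1 eq. (1)] -/
theorem stub_spsData :
    ∀ (ι : Type) [Fintype ι] [DecidableEq ι] (P : ArithCircuit ℂ ι), P.productDepth ≤ 1 →
      ∃ (T D : ℕ) (c : Fin T → ℂ) (ℓ : Fin T → Fin D → (ι → ℂ) × ℂ),
        (∑ τ, c τ • ∏ π, affVal (ℓ τ π)) = P.eval ∧ T ≤ P.edgeSize + 1 ∧ D ≤ P.edgeSize + 1 :=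
  fun _ _ _ P hP => exists_spsData_of_productDepth_le_one P hP

end Summit.ValiantsHypothesis.ValiantsHypothesis.Theorems.ShallowShadowsShadowFormulaTransfer

end
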